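import Literature.NumberTheory.DiophantineGeometry.MultiplicativeGroupApproximationProp441Proofs
import HarnessLib

/-!
# Evertse–Győry, Theorem 4.2.1 over `ℚ`: reduction to the linear-forms-in-logarithms bound

Topic `NumberTheory/DiophantineGeometry`; namespace
`Literature.NumberTheory.DiophantineGeometry.Dioph`.
Companion of `MultiplicativeGroupApproximation.lean`, which vendors Evertse–Győry,
*Unit Equations in Diophantine Number Theory* (2015), Theorem 4.2.1 for `K = ℚ` as the named
fact `evertseGyory_thm_4_2_1_rat`.

The printed proof of Theorem 4.2.1 (§4.4.2, pp. 80–81) has exactly one deep input which is not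
geometry of numbers: **Theorem 3.2.8** (p. 62), the uniform lower bound for
`log |α₁^{b₁} ⋯ αₙ^{bₙ} − 1|_v` at every place `v`, obtained in the book from Matveev's theorem
(Thm 3.2.4; Matveev 2000, Cor. 2.3) at the infinite place and from Yu's theorem (Thm 3.2.7;
Yu 2007) at the finite places — lower bounds for linear forms in (p-adic) logarithms, which are
not available in Lean. Everything else of the printed proof is now PROVED in the companion files
(`…Proofs`, `…LatticeProofs`, `…MinkowskiProofs`, `…Prop434Proofs`, `…Prop441Proofs`).

This file records the resulting **conditional theorem**
`evertseGyory_thm_4_2_1_rat_of_thm_3_2_8`: Theorem 4.2.1 for `K = ℚ` follows from the statement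
of Theorem 3.2.8 for `K = ℚ`, which appears as an explicit hypothesis (spelled out in the binder;
it is the printed statement with `d = 1`: `v ∈ M_ℚ`, `Λ = α₁^{b₁} ⋯ αₙ^{bₙ} − 1 ≠ 0` with
`n = #ι + 1 ≥ 2`, `bₙ = s = ±1`, `α₁, …, α_{n−1}` not roots of unity, `Θ = h(α₁)⋯h(α_{n−1})`,
`H = max(h(αₙ), 1)`, `B ≥ max(|b₁|, …, |b_{n−1}|, 2e(3d)^{2n} Θ H)`, conclusion
`log |Λ|_v > −C₆(n,1) (N(v)/log N(v)) Θ H log*(B N(v)/H)` with `C₆(n, 1) = egC6 n`). It is a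
genuine implication between two different published theorems, not a restatement: the hypothesis
is the Baker-type input, the conclusion the Diophantine-approximation theorem, and the proof is
the book's pp. 80–81 (height-minimal system and small exponents from Prop 4.4.1 =
`exists_small_exponents`, `B := c₁₇' h(ξ)` with the corrected `c₁₇' = m^{2m}/log 2`, Case A via the
hypothesis with `n = m+1`, `αₙ = ζ'α`, `bₙ = 1` and `eg421_caseA_bound`, Case B via the Liouville
inequality and `eg421_caseB_bound`). No named fact is introduced; the named fact
`evertseGyory_thm_4_2_1_rat` itself stays undischarged, its remaining debt being precisely
Theorem 3.2.8 for `ℚ`.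

## References

* [EvertseGyory2015] J.-H. Evertse, K. Győry, *Unit Equations in Diophantine Number Theory*,
  Cambridge Stud. Adv. Math. 146, CUP 2015 — Thm 3.2.8 (p. 62), Thm 4.2.1 (p. 68), proof of
  Thm 4.2.1 (pp. 80–81).
* [Matveev2000] E. M. Matveev, *An explicit lower bound for a homogeneous rational linear form in
  logarithms of algebraic numbers. II*, Izv. Math. 64 (2000), 1217–1269 — Cor. 2.3.
* [Yu2007] K. Yu, *p-adic logarithmic forms and group varieties. III*, Forum Math. 19 (2007),
  187–280.
-/

open Height Real Finset Module

noncomputable section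

namespace Literature.NumberTheory.DiophantineGeometry.Dioph

/-- **Evertse–Győry, Theorem 4.2.1 for `K = ℚ`, conditional on Theorem 3.2.8 for `K = ℚ`.**
The hypothesis `h328` is the printed statement of Evertse–Győry's Theorem 3.2.8 (p. 62) for
`K = ℚ`, `d = 1` (from Matveev 2000 at the infinite place and Yu 2007 at the finite places; see
the module docstring for the dictionary); the conclusion is the named fact
`evertseGyory_thm_4_2_1_rat` (Theorem 4.2.1 for `K = ℚ`). Proof along pp. 80–81: choose a
height-minimal system and small exponents (`exists_small_exponents`, i.e. Prop 4.4.1, proved),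
put `B := c₁₇' h(ξ)` with `c₁₇' = m^{2m}/log 2`; if `B ≥ 2e · 9^{m+1} Θ' H` apply the hypothesis
with `n = m + 1`, `αₙ = ζ'α`, `bₙ = 1` (`eg421_caseA_bound`); otherwise
`h(ξ) < 2e 9^{m+1} Θ H` and the Liouville inequality `log |1 − αξ|_v ≥ −log 2 − H − h(ξ)`
suffices (`eg421_caseB_bound`).
[cite: EvertseGyory2015, Thm 4.2.1 (p. 68), proof pp. 80–81] -/
theorem evertseGyory_thm_4_2_1_rat_of_thm_3_2_8
    (h328 : ∀ (ι : Type) [Fintype ι], 0 < Fintype.card ι →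
      ∀ α : ι → ℚ, (∀ i, α i ≠ 0 ∧ α i ≠ 1 ∧ α i ≠ -1) →
      ∀ β : ℚ, β ≠ 0 → ∀ s : ℤ, (s = 1 ∨ s = -1) → ∀ b : ι → ℤ,
        (∏ i, α i ^ b i) * β ^ s - 1 ≠ 0 →
      ∀ B : ℝ, (∀ i, (|b i| : ℝ) ≤ B) →
        2 * Real.exp 1 * 9 ^ (Fintype.card ι + 1) * (∏ i, logHeight₁ (α i)) *
            max (logHeight₁ β) 1 ≤ B →
        (-(egC6 (Fintype.card ι + 1) * (2 / Real.log 2) * (∏ i, logHeight₁ (α i)) *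
              max (logHeight₁ β) 1 * logStar (B * 2 / max (logHeight₁ β) 1)) <
            Real.log |(((∏ i, α i ^ b i) * β ^ s - 1 : ℚ) : ℝ)|) ∧
        ∀ p : ℕ, p.Prime →
          -(egC6 (Fintype.card ι + 1) * (p / Real.log p) * (∏ i, logHeight₁ (α i)) *
              max (logHeight₁ β) 1 * logStar (B * p / max (logHeight₁ β) 1)) <
            -(padicValRat p ((∏ i, α i ^ b i) * β ^ s - 1) : ℝ) * Real.log p) :
    evertseGyory_thm_4_2_1_rat := by
  intro ι _ hι ξ hξ α hα ζ hζ b hne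
  obtain ⟨ξ', ζ', b', hξ', hζ', hxeq, hΘle, hb'⟩ := exists_small_exponents hι ξ hξ ζ hζ b
  set m := Fintype.card ι with hm
  have hm1 : 1 ≤ m := hι
  set x : ℚ := ζ * ∏ i, ξ i ^ b i with hx
  set Θ := ∏ i, logHeight₁ (ξ i) with hΘ
  set Θ' := ∏ i, logHeight₁ (ξ' i) with hΘ'
  set H := max (logHeight₁ α) 1 with hH
  have hH1 : 1 ≤ H := le_max_right _ _
  have hH0 : 0 < H := by linarith
  have hlog2 : 0 < Real.log 2 := Real.log_pos one_lt_two
  have hΘ'pos : 0 < Θ' := by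
    apply Finset.prod_pos; intro i _
    exact lt_of_lt_of_le hlog2 (log_two_le_logHeight₁ (hξ' i).1 (hξ' i).2.1 (hξ' i).2.2)
  have hΘlow : Real.log 2 ^ m ≤ Θ := by
    have : ∏ _i : ι, Real.log 2 = Real.log 2 ^ m := by rw [Finset.prod_const, Finset.card_univ]
    rw [← this]
    exact Finset.prod_le_prod (fun i _ => hlog2.le) fun i _ =>
      log_two_le_logHeight₁ (hξ i).1 (hξ i).2.1 (hξ i).2.2
  have hhx : 0 ≤ logHeight₁ x := zero_le_logHeight₁ _
  -- c₁₇' and B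
  set c : ℝ := (m : ℝ) ^ (2 * m) / Real.log 2 with hc
  set B : ℝ := c * logHeight₁ x with hB
  have hBb : ∀ i, (|b' i| : ℝ) ≤ B := by
    intro i
    calc (|b' i| : ℝ) ≤ (m : ℝ) ^ (2 * m) * logHeight₁ x / Real.log 2 := hb' i
      _ = B := by rw [hB, hc]; ring
  -- N(v)/log N(v) ≥ e
  have hk2 : Real.exp 1 ≤ 2 / Real.log 2 := exp_one_le_div_log one_lt_two
  have hkp : ∀ p : ℕ, p.Prime → Real.exp 1 ≤ p / Real.log p := fun p hp =>
    exp_one_le_div_log (by exact_mod_cast hp.one_lt)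
  have he0 : 0 < Real.exp 1 := Real.exp_pos 1
  by_cases hcase : 2 * Real.exp 1 * 9 ^ (m + 1) * Θ' * H ≤ B
  · -- Case A: Theorem 3.2.8 with α := ξ', β := ζ' α, s := 1, b := b', B
    have hζ'0 : ζ' ≠ 0 := by rcases hζ' with rfl | rfl <;> norm_num
    have hβ : ζ' * α ≠ 0 := mul_ne_zero hζ'0 hα
    have hΛeq : (∏ i, ξ' i ^ b' i) * (ζ' * α) ^ (1 : ℤ) - 1 = -(1 - α * x) := by
      rw [zpow_one, hxeq]; ring
    have hΛ : (∏ i, ξ' i ^ b' i) * (ζ' * α) ^ (1 : ℤ) - 1 ≠ 0 := by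
      rw [hΛeq, neg_ne_zero, sub_ne_zero]; exact Ne.symm hne
    have hHβ : max (logHeight₁ (ζ' * α)) 1 = H := by
      rcases hζ' with rfl | rfl
      · rw [one_mul]
      · rw [neg_one_mul, logHeight₁_neg]
    have hB' : 2 * Real.exp 1 * 9 ^ (Fintype.card ι + 1) * (∏ i, logHeight₁ (ξ' i)) *
        max (logHeight₁ (ζ' * α)) 1 ≤ B := by rw [hHβ]; exact hcase
    obtain ⟨hA, hF⟩ := h328 ι hι ξ' hξ' (ζ' * α) hβ 1 (Or.inl rfl) b' hΛ B hBb hB'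
    rw [hHβ, hΛeq] at hA hF
    have habs : |((-(1 - α * x) : ℚ) : ℝ)| = |((1 - α * x : ℚ) : ℝ)| := by
      push_cast; rw [abs_neg]
    rw [habs] at hA
    refine ⟨?_, fun p hp => ?_⟩
    · have hkey := eg421_caseA_bound m (k := 2 / Real.log 2) (Nv := 2) hΘle hΘ'pos.le hH1 hhx
        zero_le_two (by positivity)
      have heq : (m : ℝ) ^ (2 * m) / Real.log 2 * logHeight₁ x * 2 / H = B * 2 / H := by
        rw [hB, hc]
      rw [heq] at hkey
      linarith
    · have hFp := hF p hp
      rw [padicValRat.neg] at hFp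
      have hp0 : (0 : ℝ) ≤ p := Nat.cast_nonneg p
      have hkey := eg421_caseA_bound m (k := p / Real.log p) (Nv := p) hΘle hΘ'pos.le hH1 hhx hp0
        (le_trans he0.le (hkp p hp))
      have heq : (m : ℝ) ^ (2 * m) / Real.log 2 * logHeight₁ x * p / H = B * p / H := by
        rw [hB, hc]
      rw [heq] at hkey
      linarith
  · -- Case B: Liouville
    push Not at hcase
    have hy : α * x ≠ 1 := hne
    have hhy : logHeight₁ (α * x) ≤ H + logHeight₁ x :=
      le_trans (logHeight₁_mul_le α x) (by linarith [le_max_left (logHeight₁ α) 1])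
    -- h(x) < 2e 9^{m+1} Θ' H / c ≤ 2e 9^{m+1} Θ H
    have hcpos : 0 < c := by
      rw [hc]
      have : (0 : ℝ) < m := by exact_mod_cast hm1
      positivity
    have hcinv : 1 / c ≤ 1 := by
      rw [hc, one_div_div]
      have hl2' : Real.log 2 ≤ 1 := by
        have := Real.log_two_lt_d9; linarith
      have hmm : (1 : ℝ) ≤ (m : ℝ) ^ (2 * m) := one_le_pow₀ (by exact_mod_cast hm1)
      calc Real.log 2 / (m : ℝ) ^ (2 * m) ≤ Real.log 2 / 1 :=
            div_le_div_of_nonneg_left hlog2.le one_pos hmm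
        _ ≤ 1 := by rw [div_one]; exact hl2'
    have hxlt : logHeight₁ x < 2 * Real.exp 1 * 9 ^ (m + 1) * Θ * H := by
      have h1 : logHeight₁ x = B * (1 / c) := by
        rw [hB]; field_simp
      have h2 : B * (1 / c) < (2 * Real.exp 1 * 9 ^ (m + 1) * Θ' * H) * (1 / c) :=
        mul_lt_mul_of_pos_right hcase (by positivity)
      have h3 : (2 * Real.exp 1 * 9 ^ (m + 1) * Θ' * H) * (1 / c) ≤
          (2 * Real.exp 1 * 9 ^ (m + 1) * Θ' * H) * 1 :=
        mul_le_mul_of_nonneg_left hcinv (by positivity)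
      have h4 : 2 * Real.exp 1 * 9 ^ (m + 1) * Θ' * H ≤ 2 * Real.exp 1 * 9 ^ (m + 1) * Θ * H := by
        apply mul_le_mul_of_nonneg_right _ hH0.le
        exact mul_le_mul_of_nonneg_left hΘle (by positivity)
      linarith
    have ht : Real.log 2 + logHeight₁ (α * x) <
        Real.log 2 + H + 2 * Real.exp 1 * 9 ^ (m + 1) * Θ * H := by linarith
    refine ⟨?_, fun p hp => ?_⟩
    · have h1 := liouville_infinite hy
      have h2 := eg421_caseB_bound m hm1 (k := 2 / Real.log 2)
        (L := logStar (2 * logHeight₁ x / H)) hΘlow hH1 hk2 (one_le_logStar _) ht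
      linarith
    · have h1 := liouville_finite hy p hp
      have h2 := eg421_caseB_bound m hm1 (k := p / Real.log p)
        (L := logStar (p * logHeight₁ x / H)) hΘlow hH1 (hkp p hp) (one_le_logStar _) ht
      linarith


end Literature.NumberTheory.DiophantineGeometry.Dioph

end
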